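import Summits.Ventures.PercRepro.S1Kill

/-!
# PercRepro — THE NULLITY LEVER: SETS FAR FROM A HIGH-NULLITY PART HAVE NON-SPANNING COMPLEMENTS (p2, gen 22; SUBCLAIM-S1 §6.7)

If `S ⊆ E` has nullity `≥ r` (`|S| ≥ r(S) + r`) and `B ⊆ E` has `≥ d − r + 1` points outside `S` (`d` = the corank
of `M`), then `r(E ∖ B) ≤ r(S) + |E ∖ (B ∪ S)| = n − ν(S) − |B ∖ S| < p`: the complement of `B` does not span. Such a
`B` of rank `4` is therefore NOT a `U(p, 4)`-set, although the cell form's `U`-bound counts it. Counting: the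
`4`-sets with exactly `k` points in a fixed `m`-set `O ⊆ E` number `≥ C(m, k)·C(n − m, 4 − k)`; the dependent ones
among the `4`-sets with `≥ 2` points outside `S` are four-circuits or contain a triangle not inside `S`.

* `eRk_compl_lt_of_outside` — the non-spanning complement;
* `card_fourSets_exact_ge` — the count `C(m, k)·C(n − m, 4 − k)`;
* `ncard_dep_fourSets_outside_le` — the dependent `4`-sets with `≥ 2` points outside `S`: `≤ s₄ + #{T ⊄ S}·(n − 3)`;
* **`topCount_add_excl_le`** — `#U(p, 4) + #{independent 4-sets with ≥ k points outside S} ≤ #{B : r(B) = 4, |B| ≤ d}`;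
* `excl_ge`, `excl_ge_four`, `excl_ge_all` — the excluded independent four-sets number `≥ exclCount n m k − s₄ − #{T ⊄ S}·(n − 3)`;
(The greedy chain of triangles — `exists_nullity_set` — is S1NullityChain.)
Axioms: standard.
-/

open scoped Matroid

namespace PercRepro

namespace S1

open Set

variable {α : Type}

/-- **The non-spanning complement.** `S ⊆ E` with `r(S) + r ≤ |S|`, `B ⊆ E` with `d + 1 ≤ |B ∖ S| + r`: then
`r(E ∖ B) < p` where `r(E) = p` and `|E| = p + d`. -/
theorem eRk_compl_lt_of_outside (M : Matroid α) [M.Finite] {p d : ℕ}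
    (hn : M.E.ncard = p + d) {S B : Set α} (hS : S ⊆ M.E) (hB : B ⊆ M.E) {r : ℕ}
    (hν : M.eRk S + (r : ℕ∞) ≤ (S.ncard : ℕ∞)) (hout : d + 1 ≤ (B \ S).ncard + r) :
    M.eRk (M.E \ B) < (p : ℕ∞) := by
  have hEfin : M.E.Finite := M.ground_finite
  have hSfin : S.Finite := hEfin.subset hS
  have hBfin : B.Finite := hEfin.subset hB
  -- `E ∖ B = ((E ∖ B) ∩ S) ∪ ((E ∖ B) ∖ S)`
  have hsplit : M.E \ B = ((M.E \ B) ∩ S) ∪ ((M.E \ B) \ S) := (Set.inter_union_sdiff _ _).symm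
  have h1 : M.eRk (M.E \ B) ≤ M.eRk S + ((M.E \ B) \ S).encard := by
    calc M.eRk (M.E \ B) = M.eRk (((M.E \ B) ∩ S) ∪ ((M.E \ B) \ S)) := by rw [← hsplit]
      _ ≤ M.eRk ((M.E \ B) ∩ S) + ((M.E \ B) \ S).encard := M.eRk_union_le_eRk_add_encard _ _
      _ ≤ M.eRk S + ((M.E \ B) \ S).encard := by gcongr; exact M.eRk_mono Set.inter_subset_right
  -- `|(E ∖ B) ∖ S| = n − |S| − |B ∖ S|`
  have hcount : ((M.E \ B) \ S).ncard + S.ncard + (B \ S).ncard = M.E.ncard := by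
    have e1 : (M.E \ B) \ S = M.E \ (S ∪ B) := by ext x; simp only [Set.mem_sdiff, Set.mem_union]; tauto
    have e2 : (S ∪ B).ncard = S.ncard + (B \ S).ncard := by
      rw [← Set.ncard_union_eq (Set.disjoint_sdiff_right) hSfin (hBfin.subset Set.sdiff_subset),
        Set.union_sdiff_self]
    have e3 := Set.ncard_sdiff_add_ncard_of_subset (Set.union_subset hS hB) hEfin
    rw [e1]
    omega
  have hrS : M.eRk S ≠ ⊤ := ((M.eRk_le_encard S).trans_lt hSfin.encard_lt_top).ne
  obtain ⟨rS, hrS'⟩ := ENat.ne_top_iff_exists.1 hrS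
  have hν' : rS + r ≤ S.ncard := by
    rw [← hrS'] at hν
    exact_mod_cast hν
  have hfin : ((M.E \ B) \ S).Finite := hEfin.subset (Set.sdiff_subset.trans Set.sdiff_subset)
  have h2 : M.eRk (M.E \ B) ≤ ((rS + ((M.E \ B) \ S).ncard : ℕ) : ℕ∞) := by
    rw [← hrS', ← hfin.cast_ncard_eq] at h1
    exact_mod_cast h1
  have h3 : rS + ((M.E \ B) \ S).ncard < p := by omega
  calc M.eRk (M.E \ B) ≤ ((rS + ((M.E \ B) \ S).ncard : ℕ) : ℕ∞) := h2
    _ < (p : ℕ∞) := by exact_mod_cast h3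

/-- The `4`-subsets of `E` with exactly `k` points in `O ⊆ E` (`|O| = m`): at least `C(m, k)·C(n − m, 4 − k)`. -/
theorem card_fourSets_exact_ge (M : Matroid α) [M.Finite] {O : Set α} (hO : O ⊆ M.E) {k : ℕ} (hk : k ≤ 4) :
    O.ncard.choose k * (M.E.ncard - O.ncard).choose (4 - k) ≤
      {B : Set α | B ⊆ M.E ∧ B.ncard = 4 ∧ (B ∩ O).ncard = k}.ncard := by
  classical
  have hEfin : M.E.Finite := M.ground_finite
  have hOfin : O.Finite := hEfin.subset hO
  have hDfin : (M.E \ O).Finite := hEfin.sdiff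
  -- `k`-subsets of `O` and `(4 − k)`-subsets of `E ∖ O`
  set 𝒳 : Finset (Set α) := (hOfin.toFinset.powersetCard k).image (fun s : Finset α => (s : Set α)) with h𝒳
  set 𝒴 : Finset (Set α) := (hDfin.toFinset.powersetCard (4 - k)).image (fun s : Finset α => (s : Set α)) with h𝒴
  have h𝒳card : 𝒳.card = O.ncard.choose k := card_image_powersetCard hOfin k
  have h𝒴card : 𝒴.card = (M.E \ O).ncard.choose (4 - k) := card_image_powersetCard hDfin (4 - k)
  have hmem𝒳 : ∀ X, X ∈ 𝒳 ↔ X ⊆ O ∧ X.ncard = k := fun X => mem_image_powersetCard_iff hOfin k X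
  have hmem𝒴 : ∀ Y, Y ∈ 𝒴 ↔ Y ⊆ M.E \ O ∧ Y.ncard = 4 - k := fun Y => mem_image_powersetCard_iff hDfin (4 - k) Y
  set f : Set α × Set α → Set α := fun q => q.1 ∪ q.2 with hf
  set T := {B : Set α | B ⊆ M.E ∧ B.ncard = 4 ∧ (B ∩ O).ncard = k} with hT
  have hTfin : T.Finite := hEfin.finite_subsets.subset (fun B hB => hB.1)
  have himg : ((𝒳 ×ˢ 𝒴).image f : Set (Set α)) ⊆ T := by
    intro B hB
    rw [Finset.coe_image, Set.mem_image] at hB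
    obtain ⟨⟨X, Y⟩, hXY, rfl⟩ := hB
    rw [Finset.mem_coe, Finset.mem_product] at hXY
    obtain ⟨hX, hY⟩ := hXY
    rw [hmem𝒳] at hX
    rw [hmem𝒴] at hY
    have hXfin : X.Finite := hOfin.subset hX.1
    have hYfin : Y.Finite := hDfin.subset hY.1
    have hdisj : Disjoint X Y := by
      rw [Set.disjoint_left]
      intro x hxX hxY
      exact (hY.1 hxY).2 (hX.1 hxX)
    refine ⟨Set.union_subset (hX.1.trans hO) (hY.1.trans Set.sdiff_subset), ?_, ?_⟩
    · rw [Set.ncard_union_eq hdisj hXfin hYfin, hX.2, hY.2]; omega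
    · have e : (X ∪ Y) ∩ O = X := by
        ext x
        simp only [Set.mem_inter_iff, Set.mem_union]
        constructor
        · rintro ⟨hx | hx, hxO⟩
          · exact hx
          · exact absurd hxO (hY.1 hx).2
        · intro hx; exact ⟨Or.inl hx, hX.1 hx⟩
      rw [e, hX.2]
  have hinj : Set.InjOn f ((𝒳 ×ˢ 𝒴 : Finset (Set α × Set α)) : Set (Set α × Set α)) := by
    rintro ⟨X, Y⟩ hXY ⟨X', Y'⟩ hXY' heq
    rw [Finset.mem_coe, Finset.mem_product] at hXY hXY'
    have hX := (hmem𝒳 X).1 hXY.1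
    have hY := (hmem𝒴 Y).1 hXY.2
    have hX' := (hmem𝒳 X').1 hXY'.1
    have hY' := (hmem𝒴 Y').1 hXY'.2
    simp only [hf] at heq
    have key : ∀ (X Y : Set α), X ⊆ O → Y ⊆ M.E \ O → (X ∪ Y) ∩ O = X ∧ (X ∪ Y) \ O = Y := by
      intro X Y hX hY
      constructor
      · ext x
        simp only [Set.mem_inter_iff, Set.mem_union]
        constructor
        · rintro ⟨hx | hx, hxO⟩
          · exact hx
          · exact absurd hxO (hY hx).2
        · intro hx; exact ⟨Or.inl hx, hX hx⟩
      · ext x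
        simp only [Set.mem_sdiff, Set.mem_union]
        constructor
        · rintro ⟨hx | hx, hxO⟩
          · exact absurd (hX hx) hxO
          · exact hx
        · intro hx; exact ⟨Or.inr hx, (hY hx).2⟩
    have k1 := key X Y hX.1 hY.1
    have k2 := key X' Y' hX'.1 hY'.1
    have e1 : X = X' := by rw [← k1.1, ← k2.1, heq]
    have e2 : Y = Y' := by rw [← k1.2, ← k2.2, heq]
    rw [e1, e2]
  have hcard : ((𝒳 ×ˢ 𝒴).image f).card = O.ncard.choose k * (M.E.ncard - O.ncard).choose (4 - k) := by
    rw [Finset.card_image_of_injOn hinj, Finset.card_product, h𝒳card, h𝒴card, Set.ncard_sdiff hO hOfin]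
  calc O.ncard.choose k * (M.E.ncard - O.ncard).choose (4 - k) = ((𝒳 ×ˢ 𝒴).image f).card := hcard.symm
    _ = (((𝒳 ×ˢ 𝒴).image f : Finset (Set α)) : Set (Set α)).ncard := (Set.ncard_coe_finset _).symm
    _ ≤ T.ncard := Set.ncard_le_ncard himg hTfin

/-- **The top count through the complements, keeping the spanning condition**: `A ↦ E ∖ A` injects the top sets into
`{B ⊆ E : r(B) = 4, |B| ≤ d, r(E ∖ B) = r(E)}`. -/
theorem topCount_le_ncard_compl_spanning' (M : Matroid α) [M.Finite] {p d : ℕ} (hR : M.eRank = (p : ℕ∞))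
    (hd : M.E.encard = M.eRank + d) :
    Matroid.topCount M p 4 ≤
      {B : Set α | B ⊆ M.E ∧ M.eRk B = 4 ∧ B.ncard ≤ d ∧ M.eRk (M.E \ B) = M.eRank}.ncard := by
  classical
  have hν : M✶.eRank = (d : ℕ∞) := by
    have h := _root_.Matroid.eRank_add_eRank_dual M
    rw [hd] at h
    exact WithTop.add_left_cancel (Matroid.eRank_ne_top_of_finite M) h
  unfold Matroid.topCount
  have hmaps : ∀ A ∈ {A : Set α | A ⊆ M.E ∧ M.eRk A = (p : ℕ∞) ∧ M.eRk (M.E \ A) = (4 : ℕ∞)},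
      M.E \ A ∈ {B : Set α | B ⊆ M.E ∧ M.eRk B = 4 ∧ B.ncard ≤ d ∧ M.eRk (M.E \ B) = M.eRank} := by
    intro A hA
    refine ⟨sdiff_subset, hA.2.2, ?_, ?_⟩
    · have hsp : M.Spanning A := by
        rw [_root_.Matroid.spanning_iff_eRk_le']
        exact ⟨by rw [hR, hA.2.1], hA.1⟩
      have hco : M.Coindep (M.E \ A) := by
        rw [_root_.Matroid.coindep_iff_compl_spanning sdiff_subset, sdiff_sdiff_cancel_left hA.1]
        exact hsp
      have hind : M✶.Indep (M.E \ A) := _root_.Matroid.coindep_def.1 hco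
      have h := hind.encard_le_eRank
      rw [hν, ← (M.ground_finite.sdiff).cast_ncard_eq] at h
      exact_mod_cast h
    · rw [sdiff_sdiff_cancel_left hA.1, hA.2.1, hR]
  have hinj : InjOn (fun A => M.E \ A)
      {A : Set α | A ⊆ M.E ∧ M.eRk A = (p : ℕ∞) ∧ M.eRk (M.E \ A) = (4 : ℕ∞)} := by
    intro A hA A' hA' h
    simp only at h
    rw [← sdiff_sdiff_cancel_left hA.1, h, sdiff_sdiff_cancel_left hA'.1]
  exact ncard_le_ncard_of_injOn (fun A => M.E \ A) hmaps hinj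
    (M.ground_finite.finite_subsets.subset (fun B hB => hB.1))

/-- **THE EXCLUSION**: with `S ⊆ E` of nullity `≥ r` and `d + 1 ≤ k + r`, the rank-`4` four-sets with `≥ k` points
outside `S` are not top sets: `#U(p, 4) + #{B : |B| = 4, r(B) = 4, k ≤ |B ∖ S|} ≤ #{B : r(B) = 4, |B| ≤ d}`. -/
theorem topCount_add_excl_le (M : Matroid α) [M.Finite] {p d : ℕ} (hR : M.eRank = (p : ℕ∞))
    (hd : M.E.encard = M.eRank + d) (hn : M.E.ncard = p + d) (hd4 : 4 ≤ d) {S : Set α} (hS : S ⊆ M.E) {r k : ℕ}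
    (hν : M.eRk S + (r : ℕ∞) ≤ (S.ncard : ℕ∞)) (hk : d + 1 ≤ k + r) :
    Matroid.topCount M p 4 + {B : Set α | B ⊆ M.E ∧ B.ncard = 4 ∧ M.eRk B = 4 ∧ k ≤ (B \ S).ncard}.ncard ≤
      {B : Set α | B ⊆ M.E ∧ M.eRk B = 4 ∧ B.ncard ≤ d}.ncard := by
  classical
  set X := {B : Set α | B ⊆ M.E ∧ M.eRk B = 4 ∧ B.ncard ≤ d} with hX
  set W := {B : Set α | B ⊆ M.E ∧ M.eRk B = 4 ∧ B.ncard ≤ d ∧ M.eRk (M.E \ B) = M.eRank} with hW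
  set Z := {B : Set α | B ⊆ M.E ∧ B.ncard = 4 ∧ M.eRk B = 4 ∧ k ≤ (B \ S).ncard} with hZ
  have hXfin : X.Finite := M.ground_finite.finite_subsets.subset (fun B hB => hB.1)
  have hWX : W ⊆ X := fun B hB => ⟨hB.1, hB.2.1, hB.2.2.1⟩
  have hZX : Z ⊆ X := fun B hB => ⟨hB.1, hB.2.2.1, by rw [hB.2.1]; exact hd4⟩
  have hdisj : Disjoint W Z := by
    rw [Set.disjoint_left]
    intro B hBW hBZ
    have hBk := hBZ.2.2.2
    have hlt := eRk_compl_lt_of_outside M hn hS hBZ.1 hν (by omega)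
    rw [hBW.2.2.2, hR] at hlt
    exact lt_irrefl _ hlt
  have htop : Matroid.topCount M p 4 ≤ W.ncard := topCount_le_ncard_compl_spanning' M hR hd
  have hunion : W.ncard + Z.ncard ≤ X.ncard := by
    rw [← Set.ncard_union_eq hdisj (hXfin.subset hWX) (hXfin.subset hZX)]
    exact Set.ncard_le_ncard (Set.union_subset hWX hZX) hXfin
  omega

/-- **The dependent four-sets with `≥ 2` points outside `S`** are four-circuits or contain a triangle not inside `S`:
`≤ s₄ + #{T triangle, T ⊄ S}·(n − 3)`. -/
theorem ncard_dep_fourSets_outside_le (M : Matroid α) [M.Finite]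
    (hcirc : ∀ C, M.IsCircuit C → 3 ≤ C.encard) (S : Set α) :
    {B : Set α | B ⊆ M.E ∧ B.ncard = 4 ∧ M.Dep B ∧ 2 ≤ (B \ S).ncard}.ncard ≤
      {C : Set α | M.IsCircuit C ∧ C.ncard = 4}.ncard +
      {C : Set α | M.IsCircuit C ∧ C.ncard = 3 ∧ ¬ C ⊆ S}.ncard * (M.E.ncard - 3) := by
  classical
  have hEfin : M.E.Finite := M.ground_finite
  set 𝒯 := {C : Set α | M.IsCircuit C ∧ C.ncard = 3 ∧ ¬ C ⊆ S} with h𝒯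
  have h𝒯fin : 𝒯.Finite := hEfin.finite_subsets.subset (fun C hC => hC.1.subset_ground)
  set Q := {C : Set α | M.IsCircuit C ∧ C.ncard = 4} with hQ
  have hQfin : Q.Finite := hEfin.finite_subsets.subset (fun C hC => hC.1.subset_ground)
  set K : Finset (Set α) := h𝒯fin.toFinset.biUnion (fun C => oversets hEfin C 1) with hK
  have hKcard : K.card ≤ 𝒯.ncard * (M.E.ncard - 3) := by
    calc K.card ≤ ∑ C ∈ h𝒯fin.toFinset, (oversets hEfin C 1).card := Finset.card_biUnion_le
      _ = ∑ C ∈ h𝒯fin.toFinset, (M.E.ncard - 3) := by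
          apply Finset.sum_congr rfl
          intro C hC
          rw [Set.Finite.mem_toFinset] at hC
          rw [card_oversets hEfin hC.1.subset_ground, hC.2.1, Nat.choose_one_right]
      _ = 𝒯.ncard * (M.E.ncard - 3) := by
          rw [Finset.sum_const, smul_eq_mul, ← Set.ncard_eq_toFinset_card _ h𝒯fin]
  have hsub : {B : Set α | B ⊆ M.E ∧ B.ncard = 4 ∧ M.Dep B ∧ 2 ≤ (B \ S).ncard} ⊆ Q ∪ (K : Set (Set α)) := by
    intro B hB
    obtain ⟨hBE, hB4, hdep, hout⟩ := hB
    have hBfin : B.Finite := hEfin.subset hBE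
    obtain ⟨C, hCB, hC⟩ := Matroid.Dep.exists_isCircuit_subset hdep
    have hCfin : C.Finite := hBfin.subset hCB
    have hC3 : 3 ≤ C.ncard := by
      have h := hcirc C hC
      rw [← hCfin.cast_ncard_eq] at h
      exact_mod_cast h
    have hC4 : C.ncard ≤ 4 := by rw [← hB4]; exact Set.ncard_le_ncard hCB hBfin
    rcases (show C.ncard = 3 ∨ C.ncard = 4 by omega) with h3 | h4
    · -- a triangle inside `B`, not inside `S`
      right
      have hCS : ¬ C ⊆ S := by
        intro hCS
        -- `B ∖ S ⊆ B ∖ C`, which has one element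
        have h1 : B \ S ⊆ B \ C := fun x hx => ⟨hx.1, fun hxC => hx.2 (hCS hxC)⟩
        have h2 : (B \ C).ncard = 1 := by
          rw [Set.ncard_sdiff hCB hCfin, hB4, h3]
        have := Set.ncard_le_ncard h1 (hBfin.subset Set.sdiff_subset)
        omega
      rw [Finset.mem_coe, hK, Finset.mem_biUnion]
      refine ⟨C, by rw [Set.Finite.mem_toFinset]; exact ⟨hC, h3, hCS⟩, ?_⟩
      rw [mem_oversets hEfin hC.subset_ground]
      refine ⟨hCB, hBE, ?_⟩
      rw [Set.ncard_sdiff hCB hCfin, hB4, h3]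
    · -- a four-circuit: `C = B`
      left
      have hCB' : C = B := Set.eq_of_subset_of_ncard_le hCB (by rw [h4, hB4]) hBfin
      exact ⟨hCB' ▸ hC, hCB' ▸ h4⟩
  calc {B : Set α | B ⊆ M.E ∧ B.ncard = 4 ∧ M.Dep B ∧ 2 ≤ (B \ S).ncard}.ncard
      ≤ (Q ∪ (K : Set (Set α))).ncard := Set.ncard_le_ncard hsub (hQfin.union K.finite_toSet)
    _ ≤ Q.ncard + (K : Set (Set α)).ncard := Set.ncard_union_le _ _
    _ = Q.ncard + K.card := by rw [Set.ncard_coe_finset]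
    _ ≤ Q.ncard + 𝒯.ncard * (M.E.ncard - 3) := by omega

/-- **The excluded independent four-sets**: for `S ⊆ E` with `|E ∖ S| = m` and `2 ≤ k ≤ 4`,
`C(m, k)·C(n − m, 4 − k) ≤ #{B : |B| = 4, r(B) = 4, k ≤ |B ∖ S|} + s₄ + #{T triangle, T ⊄ S}·(n − 3)`. -/
theorem excl_ge (M : Matroid α) [M.Finite] (hcirc : ∀ C, M.IsCircuit C → 3 ≤ C.encard) (S : Set α)
    {k : ℕ} (hk2 : 2 ≤ k) (hk4 : k ≤ 4) :
    (M.E \ S).ncard.choose k * (M.E.ncard - (M.E \ S).ncard).choose (4 - k) ≤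
      {B : Set α | B ⊆ M.E ∧ B.ncard = 4 ∧ M.eRk B = 4 ∧ k ≤ (B \ S).ncard}.ncard +
      ({C : Set α | M.IsCircuit C ∧ C.ncard = 4}.ncard +
        {C : Set α | M.IsCircuit C ∧ C.ncard = 3 ∧ ¬ C ⊆ S}.ncard * (M.E.ncard - 3)) := by
  classical
  have hEfin : M.E.Finite := M.ground_finite
  have hex := card_fourSets_exact_ge M (O := M.E \ S) Set.sdiff_subset hk4
  have hdep := ncard_dep_fourSets_outside_le M hcirc S
  set A := {B : Set α | B ⊆ M.E ∧ B.ncard = 4 ∧ (B ∩ (M.E \ S)).ncard = k} with hA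
  set I := {B : Set α | B ⊆ M.E ∧ B.ncard = 4 ∧ M.eRk B = 4 ∧ k ≤ (B \ S).ncard} with hI
  set D := {B : Set α | B ⊆ M.E ∧ B.ncard = 4 ∧ M.Dep B ∧ 2 ≤ (B \ S).ncard} with hD
  have hIfin : I.Finite := hEfin.finite_subsets.subset (fun B hB => hB.1)
  have hDfin : D.Finite := hEfin.finite_subsets.subset (fun B hB => hB.1)
  have hsub : A ⊆ I ∪ D := by
    intro B hB
    obtain ⟨hBE, hB4, hBk⟩ := hB
    have hBfin : B.Finite := hEfin.subset hBE
    have hBS : B \ S = B ∩ (M.E \ S) := by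
      ext x; simp only [Set.mem_sdiff, Set.mem_inter_iff]; exact ⟨fun h => ⟨h.1, hBE h.1, h.2⟩, fun h => ⟨h.1, h.2.2⟩⟩
    by_cases hind : M.Indep B
    · left
      refine ⟨hBE, hB4, ?_, by rw [hBS, hBk]⟩
      rw [hind.eRk_eq_encard, ← hBfin.cast_ncard_eq, hB4]; rfl
    · right
      refine ⟨hBE, hB4, ?_, by rw [hBS, hBk]; exact hk2⟩
      exact (M.dep_iff.2 ⟨hind, hBE⟩)
  calc (M.E \ S).ncard.choose k * (M.E.ncard - (M.E \ S).ncard).choose (4 - k) ≤ A.ncard := hex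
    _ ≤ (I ∪ D).ncard := Set.ncard_le_ncard hsub (hIfin.union hDfin)
    _ ≤ I.ncard + D.ncard := Set.ncard_union_le _ _
    _ ≤ I.ncard + ({C : Set α | M.IsCircuit C ∧ C.ncard = 4}.ncard +
        {C : Set α | M.IsCircuit C ∧ C.ncard = 3 ∧ ¬ C ⊆ S}.ncard * (M.E.ncard - 3)) := by omega

/-- **The excluded independent four-sets, with the four-sets inside `E ∖ S`** (`2 ≤ k ≤ 3`):
`C(m, k)·C(n − m, 4 − k) + C(m, 4) ≤ #{B : |B| = 4, r(B) = 4, k ≤ |B ∖ S|} + s₄ + #{T ⊄ S}·(n − 3)`. -/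
theorem excl_ge_four (M : Matroid α) [M.Finite] (hcirc : ∀ C, M.IsCircuit C → 3 ≤ C.encard) (S : Set α)
    {k : ℕ} (hk2 : 2 ≤ k) (hk3 : k ≤ 3) :
    (M.E \ S).ncard.choose k * (M.E.ncard - (M.E \ S).ncard).choose (4 - k) + (M.E \ S).ncard.choose 4 ≤
      {B : Set α | B ⊆ M.E ∧ B.ncard = 4 ∧ M.eRk B = 4 ∧ k ≤ (B \ S).ncard}.ncard +
      ({C : Set α | M.IsCircuit C ∧ C.ncard = 4}.ncard +
        {C : Set α | M.IsCircuit C ∧ C.ncard = 3 ∧ ¬ C ⊆ S}.ncard * (M.E.ncard - 3)) := by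
  classical
  have hEfin : M.E.Finite := M.ground_finite
  have hex := card_fourSets_exact_ge M (O := M.E \ S) Set.sdiff_subset (show k ≤ 4 by omega)
  have hex4 := card_fourSets_exact_ge M (O := M.E \ S) Set.sdiff_subset (show 4 ≤ 4 by omega)
  have hdep := ncard_dep_fourSets_outside_le M hcirc S
  set A := {B : Set α | B ⊆ M.E ∧ B.ncard = 4 ∧ (B ∩ (M.E \ S)).ncard = k} with hA
  set A4 := {B : Set α | B ⊆ M.E ∧ B.ncard = 4 ∧ (B ∩ (M.E \ S)).ncard = 4} with hA4
  set I := {B : Set α | B ⊆ M.E ∧ B.ncard = 4 ∧ M.eRk B = 4 ∧ k ≤ (B \ S).ncard} with hI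
  set D := {B : Set α | B ⊆ M.E ∧ B.ncard = 4 ∧ M.Dep B ∧ 2 ≤ (B \ S).ncard} with hD
  have hIfin : I.Finite := hEfin.finite_subsets.subset (fun B hB => hB.1)
  have hDfin : D.Finite := hEfin.finite_subsets.subset (fun B hB => hB.1)
  have hAfin : A.Finite := hEfin.finite_subsets.subset (fun B hB => hB.1)
  have hA4fin : A4.Finite := hEfin.finite_subsets.subset (fun B hB => hB.1)
  have hdisj : Disjoint A A4 := by
    rw [Set.disjoint_left]
    intro B hB hB4
    have := hB.2.2; have := hB4.2.2; omega
  have hsub : A ∪ A4 ⊆ I ∪ D := by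
    intro B hB
    have hBE : B ⊆ M.E := by rcases hB with h | h <;> exact h.1
    have hB4 : B.ncard = 4 := by rcases hB with h | h <;> exact h.2.1
    have hBk : k ≤ (B ∩ (M.E \ S)).ncard := by
      rcases hB with h | h
      · rw [h.2.2]
      · rw [h.2.2]; omega
    have hBfin : B.Finite := hEfin.subset hBE
    have hBS : B \ S = B ∩ (M.E \ S) := by
      ext x; simp only [Set.mem_sdiff, Set.mem_inter_iff]; exact ⟨fun h => ⟨h.1, hBE h.1, h.2⟩, fun h => ⟨h.1, h.2.2⟩⟩
    by_cases hind : M.Indep B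
    · left
      refine ⟨hBE, hB4, ?_, by rw [hBS]; exact hBk⟩
      rw [hind.eRk_eq_encard, ← hBfin.cast_ncard_eq, hB4]; rfl
    · right
      refine ⟨hBE, hB4, ?_, by rw [hBS]; omega⟩
      exact (M.dep_iff.2 ⟨hind, hBE⟩)
  have hAA : A.ncard + A4.ncard = (A ∪ A4).ncard := (Set.ncard_union_eq hdisj hAfin hA4fin).symm
  have h4 : (M.E \ S).ncard.choose 4 ≤ A4.ncard := by
    have := hex4
    rwa [Nat.sub_self, Nat.choose_zero_right, mul_one] at this
  calc (M.E \ S).ncard.choose k * (M.E.ncard - (M.E \ S).ncard).choose (4 - k) + (M.E \ S).ncard.choose 4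
      ≤ A.ncard + A4.ncard := Nat.add_le_add hex h4
    _ = (A ∪ A4).ncard := hAA
    _ ≤ (I ∪ D).ncard := Set.ncard_le_ncard hsub (hIfin.union hDfin)
    _ ≤ I.ncard + D.ncard := Set.ncard_union_le _ _
    _ ≤ I.ncard + ({C : Set α | M.IsCircuit C ∧ C.ncard = 4}.ncard +
        {C : Set α | M.IsCircuit C ∧ C.ncard = 3 ∧ ¬ C ⊆ S}.ncard * (M.E.ncard - 3)) := by omega

/-- The exclusion count used by the kernel lines: `C(m, k)·C(n − m, 4 − k) + [k ≤ 3]·C(m, 4)`. -/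
def exclCount (n m k : ℕ) : ℕ := m.choose k * (n - m).choose (4 - k) + (if k ≤ 3 then m.choose 4 else 0)

/-- **The excluded independent four-sets, all `2 ≤ k ≤ 4`**. -/
theorem excl_ge_all (M : Matroid α) [M.Finite] (hcirc : ∀ C, M.IsCircuit C → 3 ≤ C.encard) (S : Set α)
    {k : ℕ} (hk2 : 2 ≤ k) (hk4 : k ≤ 4) :
    exclCount M.E.ncard (M.E \ S).ncard k ≤
      {B : Set α | B ⊆ M.E ∧ B.ncard = 4 ∧ M.eRk B = 4 ∧ k ≤ (B \ S).ncard}.ncard +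
      ({C : Set α | M.IsCircuit C ∧ C.ncard = 4}.ncard +
        {C : Set α | M.IsCircuit C ∧ C.ncard = 3 ∧ ¬ C ⊆ S}.ncard * (M.E.ncard - 3)) := by
  unfold exclCount
  rcases Nat.lt_or_ge 3 k with h | h
  · rw [if_neg (by omega), add_zero]
    exact excl_ge M hcirc S hk2 hk4
  · rw [if_pos h]
    exact excl_ge_four M hcirc S hk2 h

end S1

end PercRepro
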